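import Literature.NumberTheory.EllipticCurves.Kato2004.ZetaBodyLayerValuesProofs
import Literature.NumberTheory.EllipticCurves.Kobayashi2003.EtaColemanInterpolation
import HarnessLib

set_option linter.dupNamespace false

/-!
# The Δ-NORM (layer) READ-OFF of the left side of the twist-scalar law `hC` of stub 2c-T1 on crux
# `CccOneLawOnTypeIstarZero` (stmt-BirchSwinnertonDyer-19223, route `InertBadSignedBranches`, skeleton istar v15)

Def-free helper file (theorems only; `--supports stmt-BirchSwinnertonDyer-19223`), refill hand
`leafhand-bsd-inertbadsignedbran-9` g0, docket of host bsd-eis-plan g43 (eis STATUS l.8229 (2)) / pen bsd-cm-plan g40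
(D1208), companion of `…TwistScalarTransport.lean` (p836061).  The left side of k-ty1 g39's named hypothesis `hC`
of `stub2cT1_of_colPlusInterpolation` reads Kobayashi's `p`-adic character sum
`padicCharSum θ (Λ_{n+1,∅} (res_{ℚ_n}^{ℚ(μ_{p^{n+1}})} (Cor_{ℚ(μ_{p^{n+1}})/ℚ_n} z_{n+1,∅})))` of the value functional
`Λ` of a `Kato2004.ZetaBody` family AT THE LAYER `ℚ_n` ([A] `Kobayashi2003.ColPlusInterpolation` evaluates `Col⁺`
on the layer classes `I.proj n y`, and `I.proj n y = levelToLayer … (z (n+1) 𝟙)` is (A4) of admissibility).  This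
file reads that element OFF in the currency of (C4)/(C5): `res ∘ cor` is the norm `Σ_δ conj_δ` over
`Gal(ℚ(μ_{p^{n+1}})/ℚ_n)` (tree theorem `resLe_coresLe_eq_sum_conjMap`), `Λ` is Galois-equivariant (C3a) with
`Λ(z_{n+1,∅}) = 1 ⊗ x_{n+1,∅}` (C4), so `Λ(res (cor z)) = 1 ⊗ Σ_δ σ_{χ_cyc(δ)} x_{n+1,∅}`
(`map_resLe_coresLe_eq_tmul_sum_sigma`, the EQUALITY form of the tree's vanishing mechanism
`sum_sigma_eq_zero_of_coresLe_eq_zero`), and a `ℂ_p`-valued Dirichlet character `θ` mod `p^{n+1}` killing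
`χ_cyc(Gal(ℚ̄/ℚ_n))` (a character of `Gal(ℚ_n/ℚ)`, e.g. `ψ^{pⁿ−1}` for `ψ` of order `2pⁿ`) has
`padicCharSum θ (Λ (res (cor z_{n+1,∅}))) = [ℚ(μ_{p^{n+1}}) : ℚ_n] · padicCharSum θ (1 ⊗ x_{n+1,∅})`
(`padicCharSum_map_resLe_levelToLayer`).  Together with p836061 (L-T) this puts the left side of `hC` in the
currency of (C5) (`charSum … x_{n+1,∅}` read through `ι`), up to the factor `[ℚ(μ_{p^{n+1}}) : ℚ_n]`.

HONEST LABEL: helper lemmas (kernel bookkeeping); nothing about `hC`, 2c-T1, 19223, X12 or BSD is proved; 2c-T1 NOT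
closed; 19223 OPEN; BSD is proved for no curve.
-/

noncomputable section

open scoped Classical TensorProduct NumberField

open Field IsDedekindDomain CongruenceSubgroup
open Literature.NumberTheory.GaloisRepresentations
open Literature.NumberTheory.EllipticCurves Literature.NumberTheory.EllipticCurves.Kato2004
open Literature.NumberTheory.EllipticCurves.Kato2004.EulerSystemValues
open Literature.NumberTheory.EllipticCurves.Kobayashi2003 Rat.HeightOneSpectrum

namespace Summit.BirchSwinnertonDyer.BirchSwinnertonDyer.Theorems.CccOneTwistScalarLayerReadOff

/-! ## §1 Kobayashi's `p`-adic character sum: additivity and `σ_h`-invariance for `θ(h) = 1` -/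

section PadicCharSum

variable (p : ℕ) [Fact p.Prime] {m : ℕ} [NeZero m] (ιp : CyclotomicField m ℚ →+* ℂ_[p])
  (θ : DirichletCharacter ℂ_[p] m)

/-- `padicCharSum` is additive in the semi-local value. [cite: Kobayashi2003, Prop. 8.25 (p. 24)] -/
theorem padicCharSum_add (y₁ y₂ : ℚ_[p] ⊗[ℚ] CyclotomicField m ℚ) :
    padicCharSum p m ιp θ (y₁ + y₂) = padicCharSum p m ιp θ y₁ + padicCharSum p m ιp θ y₂ := by
  simp only [padicCharSum_def, map_add, mul_add, Finset.sum_add_distrib]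

/-- `padicCharSum` of a finite sum. [cite: Kobayashi2003, Prop. 8.25 (p. 24)] -/
theorem padicCharSum_sum {α : Type*} (s : Finset α) (g : α → ℚ_[p] ⊗[ℚ] CyclotomicField m ℚ) :
    padicCharSum p m ιp θ (∑ i ∈ s, g i) = ∑ i ∈ s, padicCharSum p m ιp θ (g i) :=
  map_sum (AddMonoidHom.mk' (padicCharSum p m ιp θ) (padicCharSum_add p ιp θ)) g s

/-- On a rational tensor: `padicCharSum θ (s ⊗ x) = s · Σ_b θ(b) ιp(σ_b x)`. [cite: Kobayashi2003, Prop. 8.25 and (8.29) (p. 24)] -/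
theorem padicCharSum_tmul (s : ℚ_[p]) (x : CyclotomicField m ℚ) :
    padicCharSum p m ιp θ (s ⊗ₜ[ℚ] x) =
      algebraMap ℚ_[p] ℂ_[p] s * ∑ b : (ZMod m)ˣ, θ (b : ZMod m) * ιp (sigma m b x) := by
  simp only [padicCharSum_def, padicReadOff_tmul, Finset.mul_sum]
  exact Finset.sum_congr rfl fun b _ ↦ by ring

/-- **`σ_h`-invariance**: `padicCharSum θ (s ⊗ σ_h x) = padicCharSum θ (s ⊗ x)` when `θ(h) = 1` (re-index `b ↦ bh`;
twin of the tree's complex `charSum_sigma_of_apply_eq_one`). [cite: Kato2004Asterisque, Thm. 6.6 (1) (p. 163)] -/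
theorem padicCharSum_tmul_sigma_of_apply_eq_one {h : (ZMod m)ˣ} (hh : θ (h : ZMod m) = 1) (s : ℚ_[p])
    (x : CyclotomicField m ℚ) :
    padicCharSum p m ιp θ (s ⊗ₜ[ℚ] sigma m h x) = padicCharSum p m ιp θ (s ⊗ₜ[ℚ] x) := by
  rw [padicCharSum_tmul, padicCharSum_tmul]
  congr 1
  calc ∑ b : (ZMod m)ˣ, θ (b : ZMod m) * ιp (sigma m b (sigma m h x))
      = ∑ b : (ZMod m)ˣ, θ ((b * h : (ZMod m)ˣ) : ZMod m) * ιp (sigma m (b * h) x) := by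
        refine Finset.sum_congr rfl fun b _ => ?_
        rw [sigma_mul_apply, Units.val_mul, map_mul, hh, mul_one]
    _ = ∑ b : (ZMod m)ˣ, θ (b : ZMod m) * ιp (sigma m b x) :=
        Fintype.sum_equiv (Equiv.mulRight h) _ _ (fun _ => rfl)

/-- **Norm elements are read as multiples**: `padicCharSum θ (1 ⊗ Σ_{i ∈ s} σ_{h_i} x) = #s · padicCharSum θ (1 ⊗ x)`
when `θ(h_i) = 1` for all `i ∈ s`. [cite: Kato2004Asterisque, §13.8 (p. 228)] -/
theorem padicCharSum_tmul_sum_sigma {α : Type*} (s : Finset α) {h : α → (ZMod m)ˣ}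
    (hh : ∀ i ∈ s, θ (h i : ZMod m) = 1) (x : CyclotomicField m ℚ) :
    padicCharSum p m ιp θ ((1 : ℚ_[p]) ⊗ₜ[ℚ] ∑ i ∈ s, sigma m (h i) x) =
      (s.card : ℂ_[p]) * padicCharSum p m ιp θ ((1 : ℚ_[p]) ⊗ₜ[ℚ] x) := by
  rw [TensorProduct.tmul_sum, padicCharSum_sum,
    Finset.sum_congr rfl fun i hi => padicCharSum_tmul_sigma_of_apply_eq_one p ιp θ (hh i hi) 1 x,
    Finset.sum_const, nsmul_eq_mul]

end PadicCharSum

/-! ## §2 The mechanism: `Λ (res (cor ξ)) = 1 ⊗ Σ_δ σ_{χ_cyc(δ)} x₁` for an equivariant `Λ` with `Λ ξ = 1 ⊗ x₁` -/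

section Mechanism

variable {W : WeierstrassCurve ℚ} [W.IsElliptic] {p : ℕ} [Fact p.Prime]
  [ContinuousSMul ℤ_[p] (W.tateModule p)]

/-- **The EQUALITY form of the tree's `sum_sigma_eq_zero_of_coresLe_eq_zero`.** Let `Λ₀ : H¹(ℚ(μ_m), T_pW) → ℚ_p ⊗ ℚ(ζ_m)`
(`m = m(k,r)`) be `ℤ_p`-linear and `Gal(ℚ(μ_m)/ℚ)`-equivariant ((C3a) shape), `ξ` a class with `Λ₀ ξ = 1 ⊗ x₁` ((C4)
shape), `U ≥ Gal(ℚ̄/ℚ(μ_m))`.  Then `Λ₀ (res_U (cor_U ξ)) = 1 ⊗ Σ_{y ∈ U/Gal(ℚ̄/ℚ(μ_m))} σ_{χ_cyc(s(y))} x₁` for the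
representatives `s = Quotient.out` (`res ∘ cor = Σ conj_{s(y)}`, tree theorem `resLe_coresLe_eq_sum_conjMap`).
[cite: NeukirchSchmidtWingberg2008, I §5 (1.5.6)–(1.5.7)] [cite: Kato2004Asterisque, §13.8 (p. 228)] -/
theorem map_resLe_coresLe_eq_tmul_sum_sigma {U : Subgroup (absoluteGaloisGroup ℚ)} (k : ℕ)
    (r : Finset (HeightOneSpectrum (𝓞 ℚ))) (hle : cycSubgroup p k r ≤ U)
    [Fintype (U ⧸ (cycSubgroup p k r).subgroupOf U)]
    (Λ₀ : H1 (tateRep W p) (cycSubgroup p k r) →ₗ[ℤ_[p]] ℚ_[p] ⊗[ℚ] CyclotomicField (cycLevel p k r) ℚ)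
    (hΛ : ∀ (σ : absoluteGaloisGroup ℚ) (y : H1 (tateRep W p) (cycSubgroup p k r)),
      Λ₀ (conjMap (tateRep W p).toTopRep (cycSubgroup p k r) σ 1 y) =
        Algebra.TensorProduct.map (AlgHom.id ℚ ℚ_[p])
          (sigma (cycLevel p k r) (modNCyclotomicCharacter ℚ (cycLevel p k r) σ) :
            CyclotomicField (cycLevel p k r) ℚ →ₐ[ℚ] CyclotomicField (cycLevel p k r) ℚ) (Λ₀ y))
    {ξ : H1 (tateRep W p) (cycSubgroup p k r)} {x₁ : CyclotomicField (cycLevel p k r) ℚ}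
    (hξ : Λ₀ ξ = (1 : ℚ_[p]) ⊗ₜ[ℚ] x₁) :
    Λ₀ (resLe (tateRep W p).toTopRep hle 1
        (coresLe (tateRep W p).toTopRep hle ((cyclotomicLevelsRat p ∅).isOpen_level k r) ξ)) =
      (1 : ℚ_[p]) ⊗ₜ[ℚ] ∑ y : U ⧸ (cycSubgroup p k r).subgroupOf U,
        sigma (cycLevel p k r)
          (modNCyclotomicCharacter ℚ (cycLevel p k r) ((Quotient.out y : U) : absoluteGaloisGroup ℚ)) x₁ := by
  have hs : ∀ y : U ⧸ (cycSubgroup p k r).subgroupOf U,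
      ((Quotient.out y : U) : U ⧸ (cycSubgroup p k r).subgroupOf U) = y :=
    fun y => QuotientGroup.out_eq' y
  rw [resLe_coresLe_eq_sum_conjMap (tateRep W p).toTopRep hle ((cyclotomicLevelsRat p ∅).isOpen_level k r) hs ξ,
    map_sum, TensorProduct.tmul_sum]
  refine Finset.sum_congr rfl fun y _ => ?_
  rw [hΛ, hξ, Algebra.TensorProduct.map_tmul]
  rfl

end Mechanism

/-! ## §3 The `ZetaBody` family at the layer `ℚ_n`: the left side of `hC` read off in (C4)/(C5) currency -/

section LayerReadOff

variable {W : WeierstrassCurve ℚ} [W.IsElliptic] {p : ℕ} [Fact p.Prime]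
  [ContinuousSMul ℤ_[p] (W.tateModule p)] [Module.Free ℤ_[p] (W.tateModule p)]
  [Module.Finite ℤ_[p] (W.tateModule p)] {N : ℕ} {f : CuspForm (Gamma0 N) 2}
  {ι : (m : ℕ) → (CyclotomicField m ℚ →+* ℂ)} {κ' : ℝ}
  {Λ' : ∀ (k : ℕ) (r : Finset (HeightOneSpectrum (𝓞 ℚ))),
    H1 (tateRep W p) (cycSubgroup p k r) →ₗ[ℤ_[p]] ℚ_[p] ⊗[ℚ] CyclotomicField (cycLevel p k r) ℚ}
  {c d a : ℤ} {A : ℕ}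
  {z : ∀ (k : ℕ) (r : (cyclotomicLevelsRat p (badPlaces c d A N)).Ideals),
    H1 (tateRep W p) ((cyclotomicLevelsRat p (badPlaces c d A N)).level k r.1)}
  {x : ∀ (k : ℕ) (r : (cyclotomicLevelsRat p (badPlaces c d A N)).Ideals),
    CyclotomicField (cycLevel p k r.1) ℚ}
  {K : ZpExtension ℚ p}

/-- **`Λ` of the layer class, restricted back to the level, is `1 ⊗ (the Δ-norm of x_{n+1,∅})`.**  For a `ZetaBody`
family `(Λ, κ, z, x)`, a cyclotomic `K`, `p` odd and `n`:
`Λ_{n+1,∅} (res_{ℚ_n}^{ℚ(μ_{p^{n+1}})} (Cor_{ℚ(μ_{p^{n+1}})/ℚ_n} z_{n+1,∅})) = 1 ⊗ Σ_{δ} σ_{χ_cyc(δ)} x_{n+1,∅}`, `δ`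
over the representatives `Quotient.out` of `Gal(ℚ̄/ℚ_n)/Gal(ℚ̄/ℚ(μ_{p^{n+1}}))` (`levelToLayer` IS that corestriction;
(C3a) + (C4) + `resLe_coresLe_eq_sum_conjMap`).  The `Fintype` instance on the quotient is `Fintype.ofFinite`, the
one baked into `levelToLayer`. [cite: Kato2004Asterisque, §13.8 (p. 228), Thm. 9.7 (p. 189)]
[cite: NeukirchSchmidtWingberg2008, I §5 (1.5.6)–(1.5.7)] -/
theorem map_resLe_levelToLayer_eq_tmul_sum_sigma (hbody : ZetaBody W p f ι κ' Λ' c d a A z x)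
    (hK : K.IsCyclotomic) (hp : p ≠ 2) (n : ℕ) :
    letI : Fintype (K.layerSubgroup n ⧸ (cycSubgroup p (n + 1) ∅).subgroupOf (K.layerSubgroup n)) :=
      Fintype.ofFinite _
    Λ' (n + 1) ∅ (resLe (tateRep W p).toTopRep (hK.cyclotomicLevelsRat_level_succ_le_layerSubgroup hp ∅ n) 1
        (levelToLayer W p hK hp (badPlaces c d A N) n
          (z (n + 1) (cyclotomicLevelsRat p (badPlaces c d A N)).idealOne))) =
      (1 : ℚ_[p]) ⊗ₜ[ℚ] ∑ y : K.layerSubgroup n ⧸ (cycSubgroup p (n + 1) ∅).subgroupOf (K.layerSubgroup n),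
        sigma (cycLevel p (n + 1) ∅)
          (modNCyclotomicCharacter ℚ (cycLevel p (n + 1) ∅)
            ((Quotient.out y : K.layerSubgroup n) : absoluteGaloisGroup ℚ))
          (x (n + 1) (cyclotomicLevelsRat p (badPlaces c d A N)).idealOne) := by
  have hle : cycSubgroup p (n + 1) ∅ ≤ K.layerSubgroup n :=
    hK.cyclotomicLevelsRat_level_succ_le_layerSubgroup hp (badPlaces c d A N) n
  letI : Fintype (K.layerSubgroup n ⧸ (cycSubgroup p (n + 1) ∅).subgroupOf (K.layerSubgroup n)) :=
    Fintype.ofFinite _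
  obtain ⟨-, -, hC3a, -, hC4, -⟩ := hbody
  have hξ : Λ' (n + 1) ∅ (z (n + 1) (cyclotomicLevelsRat p (badPlaces c d A N)).idealOne) =
      (1 : ℚ_[p]) ⊗ₜ[ℚ] (x (n + 1) (cyclotomicLevelsRat p (badPlaces c d A N)).idealOne :
        CyclotomicField (cycLevel p (n + 1) ∅) ℚ) :=
    hC4 (n + 1) (cyclotomicLevelsRat p (badPlaces c d A N)).idealOne
  have key := map_resLe_coresLe_eq_tmul_sum_sigma (n + 1) ∅ hle (Λ' (n + 1) ∅) (hC3a (n + 1) ∅) hξ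
  unfold levelToLayer
  exact key

/-- **THE Δ-NORM READ-OFF of `hC`'s left side.**  For a `ZetaBody` family `(Λ, κ, z, x)`, a cyclotomic `K`, `p` odd, `n`,
a `p`-adic embedding `ιp` of `ℚ(ζ_{p^{n+1}})` and a `ℂ_p`-valued Dirichlet character `θ` mod `p^{n+1}` trivial on
`χ_cyc(Gal(ℚ̄/ℚ_n))` (a character of `Gal(ℚ_n/ℚ)`):
`padicCharSum θ (Λ_{n+1,∅} (res (Cor_{ℚ(μ_{p^{n+1}})/ℚ_n} z_{n+1,∅}))) = [Gal(ℚ̄/ℚ_n) : Gal(ℚ̄/ℚ(μ_{p^{n+1}}))] · padicCharSum θ (1 ⊗ x_{n+1,∅})`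
— the semi-local value entering [A] `ColPlusInterpolation` at the layer class, read in the currency of (C4)/(C5).
[cite: Kato2004Asterisque, §13.8 (p. 228), Thm. 9.7 (p. 189)] [cite: Kobayashi2003, Prop. 8.25 (p. 24)]
[cite: NeukirchSchmidtWingberg2008, I §5 (1.5.6)–(1.5.7)] -/
theorem padicCharSum_map_resLe_levelToLayer (hbody : ZetaBody W p f ι κ' Λ' c d a A z x)
    (hK : K.IsCyclotomic) (hp : p ≠ 2) (n : ℕ)
    (ιp : CyclotomicField (cycLevel p (n + 1) ∅) ℚ →+* ℂ_[p])
    (θ : DirichletCharacter ℂ_[p] (cycLevel p (n + 1) ∅))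
    (hθ : ∀ σ ∈ K.layerSubgroup n,
      θ ((modNCyclotomicCharacter ℚ (cycLevel p (n + 1) ∅) σ : (ZMod (cycLevel p (n + 1) ∅))ˣ) :
        ZMod (cycLevel p (n + 1) ∅)) = 1) :
    padicCharSum p (cycLevel p (n + 1) ∅) ιp θ
        (Λ' (n + 1) ∅ (resLe (tateRep W p).toTopRep (hK.cyclotomicLevelsRat_level_succ_le_layerSubgroup hp ∅ n) 1
          (levelToLayer W p hK hp (badPlaces c d A N) n
            (z (n + 1) (cyclotomicLevelsRat p (badPlaces c d A N)).idealOne)))) =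
      (Nat.card (K.layerSubgroup n ⧸ (cycSubgroup p (n + 1) ∅).subgroupOf (K.layerSubgroup n)) : ℂ_[p]) *
        padicCharSum p (cycLevel p (n + 1) ∅) ιp θ
          ((1 : ℚ_[p]) ⊗ₜ[ℚ] x (n + 1) (cyclotomicLevelsRat p (badPlaces c d A N)).idealOne) := by
  letI : Fintype (K.layerSubgroup n ⧸ (cycSubgroup p (n + 1) ∅).subgroupOf (K.layerSubgroup n)) :=
    Fintype.ofFinite _
  rw [map_resLe_levelToLayer_eq_tmul_sum_sigma hbody hK hp n,
    padicCharSum_tmul_sum_sigma p ιp θ Finset.univ (fun y _ => hθ _ (Quotient.out y).2),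
    Finset.card_univ, Nat.card_eq_fintype_card]

end LayerReadOff

end Summit.BirchSwinnertonDyer.BirchSwinnertonDyer.Theorems.CccOneTwistScalarLayerReadOff

end
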